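import Mathlib
import HarnessLib
import HarnessLib.Audit
import Summits.Langlands.Statement
import Summits.Langlands.Langlands.Theses.DescentTypeTrichotomy
import Literature.NumberTheory.Automorphic.AutomorphicRepsGLSatakeFlathProofs
import HarnessLib.Audit.Status.Attr

/-!
Route: FaltingsSerreTransfer

# Route FaltingsSerreTransfer — the primitive dark residual PRIM =
`DescentTypeTrichotomy.PrimitiveTypeAutomorphy` (stmt-Langlands-29575: weak automorphy of every
irreducible pinned-geometric Lie-irreducible ρ : Γ_K → GL_n(ℚ̄_ℓ), n ≥ 2, that is not potentially a
solvable twist-descent to a TR/CM field — non-vacuous exactly over K neither TR nor CM, where BOTH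
directions of reciprocity are dark) is, after ONE certified translation into the language of
HECKE–FROBENIUS CERTIFICATES («(π, ρ) Satake–Frobenius compatible a.e.» ⟺ «(π, ρ) certified on
Chebotarev-covering finite sets of every depth», kernel `aeCompatible_iff_certified`, modulo the
Faltings–Serre criterion FS, Chebotarev–Hermite and an ℓ-adic avatar of π), the conjunction CERT ∧
AVC: CERT = every PRIM-box ρ is CERTIFIED against some L-algebraic cuspidal π (finite matching of
every depth — what the Gunnells–Yasaki tables exhibit), AVC = every cuspidal π so certified has an
ℓ-adic avatar (the (A)-dark core, a sub-box of W⁺ 17415, declared residual). It suffices to show FS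
∧ CERT ∧ AVC (kernel `closes`); conversely PRIM ⇒ CERT (`cert_of_prim`) and Langlands ⇒ AVC
(`avc_of_langlands`), and PRIM ⟺ CERT modulo FS, CHEB, AVC (`target_iff_cert`).
Lean: FaltingsSerreCriterion → CertifiedMatching → CertificateAvatars →
Summit.Langlands.Langlands.Theses.DescentTypeTrichotomy.PrimitiveTypeAutomorphy

REFINES route-Langlands-DescentTypeTrichotomy:PrimitiveTypeAutomorphy (edge split, depth 1; chain
route-Langlands-DescentTypeTrichotomy › route-Langlands-FaltingsSerreTransfer) — the deciding
theorem of this CHILD route concludes the parent piece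
`Summit.Langlands.Langlands.Theses.DescentTypeTrichotomy.PrimitiveTypeAutomorphy` BY NAME (imported
from Summits.Langlands.Langlands.Theses.DescentTypeTrichotomy); closing this route proves that piece
of the parent, never the summit Statement (D-0170).

Rationale: WHY THIS LINE. PRIM is the bottom of the cell DescentTypeTrichotomy (rank 1 | solvable type |
insolvable type → DESC ∧ PRIM) and its header records «PRIM is not decomposed at all (IDEA-NEEDED)»;
every box-level cut beneath it is either taken or barrier-certified terminal
(UnreachableTerminalCertificate: for box carvings of the r₂ > 0, no-TR/CM-structure population
nothing in print reaches any sub-box). This child does not cut the box. It changes the CURRENCY in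
which the (B)-statement is paid: Satake–Frobenius compatibility at almost all places is, by
Faltings–Serre (Faltings 1983; Serre 1984–85; Livné 1987; Grenié 2007; Freitas–Sánchez 2025
arXiv:2510.12956 p.8: traces on a set covering the deviation group decide the semisimplification)
and Chebotarev, EQUIVALENT to the existence of finite certificates of every depth — PROVIDED π has
an ℓ-adic avatar ρ_π to run Faltings–Serre on the Galois side (ρ versus ρ_π). The dictionary is
proved in kernel (`aeCompatible_iff_certified`; Satake parameters are unique,
`hasSatakeParamAt_unique_holds`). Hence PRIM factors EXACTLY through two named dark statements of
different nature: CERT (produce π and finite certificates: per (instance, depth) a terminating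
computation, CERT(ρ) itself ∀-quantified over depths — Gunnells–Yasaki /
Donnelly–Gunnells–Klages-Mundt–Yasaki verify one depth of this over the −23 cubic field, and cannot
conclude modularity for want of ρ_π) and AVC (attach ρ_π to certified π: direction (A) over
non-TR/CM fields, the Shimura-variety barrier head-on). The imported structure is the Faltings–Serre
deviation-group/class-field mechanism, present in the tree only as the BPPTVY kernel for residually
absolutely irreducible ℤ_ℓ-representations of Γ_ℚ (paramodularity cell) and never used on this
summit's (B)-side items; the new move is to make the (A)-dark core LOAD-BEARING for the (B)-dark
residual by kernel, so that the two dark boxes of the cell become one ladder: AVC (⊂ W⁺) below,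
finite certificates above.
RANKED CRUXES. 2 CertifiedMatching (deciding; first instance E′/ℚ(α) vs the Gunnells–Yasaki
eigenclass, instrument I-g19.1 = one Faltings–Serre covering-set computation); 3 CertificateAvatars
(declared residual; sub-box of W⁺ 17415 / E 23598 / G 29147, dominated by name); 9
FaltingsSerreCriterion (print, provable now, est. L — its landing makes the transfer unconditional);
1 Assembly (proved).
KILL CRITERIA. (i) A PRIM-box ρ over some K for which NO cuspidal π matches even one depth-B
certificate (a finite computation contradicting CERT at an instance — e.g. an E′/ℚ(α) whose point
counts match no GL₂ eigenclass of the predicted level) refutes CERT, PRIM and Langlands at once;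
(ii) a proof that certified matching of some fixed depth already forces a.e. matching WITHOUT an
avatar would make AVC decorative (not expected: without ρ_π nothing links Hecke eigenvalues at
different primes); (iii) FS refuted as typed (a mis-typed covering notion) kills the transfer —
cheapest check: the kernel `aeCompatible_of_certified` already consumes FS exactly as typed, and
FS's truth is the Faltings–Serre–Grenié argument with B = q^{2n²}.
NOT DECOMPOSED YET. No dial on K, n, ℓ or the residual image inside the items. DEPTH RULE (binding):
below CERT only its birth stubs (rank dial n = 2 | n ≥ 3, the n = 2 stub doubling as the BC5
plan-only rung, instrument-only per (instance, depth)) and INSTRUMENT verdicts / per-instance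
certificate theorems as support (never a child route carving PRIM's box —
UnreachableTerminalCertificate); below AVC nothing but by-name domination (W⁺, E, G) and engine
landings of direction (A); FS takes provers' lemmas only (Baire reduction, deviation group,
Nakayama, Newton). CHEB (covering sets exist, Chebotarev–Hermite) is a node-only definition used by
the necessity kernels, not an item (vendorable as a Literature fact, crit a5). Idea seed s1 (crit
row 298): a FIXED-DEPTH variant CERT° closable per instance would need a local–global-compatible
avatar (not root-implied today) — an idea card, not an item of this route.
CHEAPEST FALSIFIER. `lean check probes/probes_p0.lean`: CERT, AVC, FS ↛ PRIM and ↛ Langlands by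
exact?/simpa/aesop, CERT → AVC ↛ PRIM without FS; and one instance computation (I-g19.1): the
Faltings–Serre covering set for (T_ℓ E′, ρ_?) cannot even be STARTED on the automorphic side without
ρ_π — which is the point: the instance verifies CERT (finite Hecke data of GY) and exhibits AVC as
the exact missing input.

Novelty: Searches RUN 2026-08-31 (corpus fts+vec AND galaxy, labelled). `lit search --hybrid "Faltings Serre
method comparing l-adic Galois representations finitely many Frobenius traces"` →
[corpus:book:edixhoven2011-computational-aspects-modular-forms-galois-representations-how p347],
[corpus:book:cornell1997-modular-forms-fermats-last-theorem p377],
[corpus:book:david1995-number-theory-paris-19923 p62-65] (FS method expositions; none transfers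
automorphy through an avatar); `lit search "Grenié semi-simplifications Galois"` →
[corpus:paper:arxiv-2510.12956 p3,p8,p18] READ (Freitas–Sánchez 2025: deviation group, covering
sets, residually reducible case), [corpus:paper:arxiv-math_0506053] (Grenié 2007),
[corpus:paper:arxiv-1811.11544 p14]; `lit search "Gunnells Yasaki … discriminant -23"` →
[corpus:paper:arxiv-1201.4132 p2,p3,p14] READ (computational modularity evidence over the −23 cubic
field = finite certificates, no theorem), doi:10.1080/10586458.2014.1002141 [graph:doi]; `lit search
"Dieulefait Guerberoff Pacetti …"` → [corpus:paper:arxiv-0804.2302] (per-curve FS over imaginary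
quadratic K — a CM field, where ρ_π exists by Taylor/HLTT); `lit vsearch "modularity of elliptic
curves over number fields that are neither totally real nor CM …"` → textbook noise only (no hits
treating the non-TR/CM case); `lit galaxy search "Faltings-Serre method|Faltings–Serre method|method
of Faltings and Serre" --star all` → [galaxy:panama:506015866945592] (Cornell–Silverman–Stevens),
[galaxy:panama:  [refs: 10.1080/10586458.2014.1002141, book:edixhoven2011-computational-aspects-modular-forms-galois-representations-how, book:cornell1997-modular-forms-fermats-last-theorem, book:david1995-number-theory-paris-19923, paper:arxiv-2510.12956, paper:arxiv-math_0506053, paper:arxiv-1811.11544, paper:arxiv-1201.4132, doi:10.1080/10586458.2014.1002141, paper:arxiv-0804.2302]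

Barriers (technique_class: Faltings-Serre transfer; Hecke-Frobenius certificates): - technique_class: Faltings–Serre / deviation-group comparison of ℓ-adic Galois representations
(class field theory of bounded degree + Chebotarev) used as a transfer of weak automorphy through an
ℓ-adic avatar; explicit Hecke-eigenvalue certificates (arithmetic cohomology of GL_n over non-TR/CM
fields)
- Literature.Barriers.Langlands.FamilyWitnessConsecutiveWeights: outside this route's technique
class; no item in scope.
- Literature.Barriers.Langlands.ResiduallyReducibleBarrier: does not bite — FS is typed
residual-free (class-covering over ALL groups of order ≤ B, Grenié/Freitas–Sánchez form), precisely
so that residually reducible ρ in PRIM's box are covered; CERT/AVC make no residual hypothesis; no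
Taylor–Wiles patching occurs anywhere in the line.
- Literature.Barriers.Langlands.MonodromyNotClosedUnderPadicLimits: not applicable (no Artin-image,
self-duality, ℓ = p component or monodromy statement occurs; PRIM's box excludes the
solvable-descent types by hypothesis).
- Literature.Barriers.Langlands.PatchingLocalComponentBarrier: not applicable (no Artin-image,
self-duality, ℓ = p component or monodromy statement occurs; PRIM's box excludes the
solvable-descent types by hypothesis).
- Literature.Barriers.Langlands.TaylorWilesNumericalCoincidence: APPLIES to any future attack on AVC
or on CERT-as-∀ by patching over K (l₀ = r₂ > 0: the numerical coincidence fails); the line imports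
no patching — recorded as the reason both open pieces are tagged IDEA-NEEDED rather than ATT

sub-problem: Langlands · status: draft · opened planner-decomp-langlands-writer-1-g7-0 2026-08-31T05:36:45Z · rev 0 · ledger route-Langlands-FaltingsSerreTransfer
GENERATED by the gate from the ledger (D-0016/17). Provers cite these decls: `theorem foo : Summit.Langlands.Langlands.Theses.FaltingsSerreTransfer.<Decl> := …` in Summits/Langlands/Langlands/Theorems/<Name>.lean.
-/

namespace Summit.Langlands.Langlands.Theses.FaltingsSerreTransfer

open scoped BigOperators Topology Manifold Classical MeasureTheory ProbabilityTheory Matrix InnerProductSpace ComplexConjugate ContinuousMap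
open Filter Set Function TopologicalSpace MeasureTheory

attribute [summit_statement] _root_.Langlands
attribute [summit_statement] _root_.Summit.Langlands.Langlands.Theses.DescentTypeTrichotomy.PrimitiveTypeAutomorphy

/-- item stmt-Langlands-28079 · crux · leaf IDEA-NEEDED · rank 2 · open · by planner
why it might fail: As a ∀-statement it is as dark as PRIM: producing π at all for a primitive ρ over a field with r₂ > 0 and no TR/CM subfield structure has no method (no potential automorphy over any extension, no Shimura variety); only its per-instance finite certificates are accessible.
sources: arXiv:1201.4132 = doi:10.1142/s1793042112501242 (Gunnells–Yasaki 2013, −23 cubic field: p.3 «matching of Euler factors at good primes … complete agreement», p.14 «perfect agreement … within the range» — finite certificates, no modularity theorem) [corpus:paper:arxiv-1201.4132 p3,p14], arXiv:1409.7911 = doi:10.1080/10586458.2014.1002141 (Donnelly–Gunnells–Klages-Mundt–Yasaki 2015, table of elliptic curves over the −23 cubic field), arXiv:0804.2302 = doi:10.1090/s0025-5718-09-02291-1 (Dieulefait–Guerberoff–Pacetti 2010: the per-instance Faltings–Serre modularity template, imaginary quadratic K) [corpus:paper:arxiv-0804.2302], HOME/census/COSTUME-CENSUS-v24 atom AT3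 (E′/ℚ(α), α³ − α − 1 = 0, v_𝔭(j) < 0 at one 𝔭 | 59; GY eigenclass) and H1 (FS ask), arXiv:2510.12956 p.3 (Faltings: finitely many Frobenius traces decide) and p.8 (deviation group δ(G) ⊂ (M/ϖM)^×, M = 𝒪_E-span of (ρ₁⊕ρ₂)(G_K) ⊂ M_n(𝒪_E)²; «semisimplifications isomorphic iff traces agree on a set covering δ(G)»; K_δ/K unramified outside S) [corpus:paper:arxiv-2510.12956 p8], Literature.Barriers.Langlands.ShimuraVarietyRealizationBarrier (why no ρ_π exists to transfer from: l₀ = r₂ > 0)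
[CERT · CERTIFIED MATCHING · WEAKER than PRIM (node `cert_of_prim`, mod Chebotarev–Hermite) and than
the summit (`cert_of_langlands`); NOT known to imply PRIM (over these K no cuspidal π of GL_n, n ≥
2, has a Galois representation) · INSTRUMENTABLE per (instance, depth) only: ONE certificate = a
finite Hecke-eigenvalue computation on a covering set, while CERT(ρ) still quantifies ∀ B ∀ S′ and
is never computation-closable (crit-1 row 298 e1) · IDEA-NEEDED as a ∀-statement] PRIM's binders and
box VERBATIM (K, n ≥ 2, ℓ, ι, ρ irreducible, pinned-geometric, Lie-irreducible, not potentially a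
solvable twist-descent to a TR/CM field); conclusion: there is an L-algebraic cuspidal π on GL_n/K
such that for EVERY depth B and every finite S′ there is a finite set T of places, disjoint from S′
and (S′, B)-COVERING (for every finite group H with |H| ≤ B and every continuous φ : Γ_K → H
unramified outside S′, every φ(g) is conjugate to φ(Frob) for an arithmetic Frobenius above some v ∈
T), with Satake(π_v) ↔ charpoly ρ(Frob_v) at every v ∈ T (`SatakeFrobCompatibleAt`). Token diff vs
PRIM: only the clause after `π.1.IsLAlgebraic ∧`. First box (census atom AT3): K = ℚ(α), α³ − α − 1
= 0, ρ = T_ℓ -/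
@[route_item "route-Langlands-FaltingsSerreTransfer", crux (bottleneck := idea) (source := "ledger D-0171 leaf tag IDEA-NEEDED on stmt-Langlands-28079, 2026-09-01")]
def CertifiedMatching : Prop :=
  ∀ (K : Type) [Field K] [NumberField K] (n : ℕ) (hcpt : Literature.NumberTheory.Automorphic.isCompact_glFiniteIntegralLevel n K), 2 ≤ n → ∀ (ℓ : ℕ) [Fact ℓ.Prime] (ι : PadicAlgCl ℓ ≃+* ℂ) (ρ : Literature.NumberTheory.GaloisRepresentations.FramedGaloisRep K (PadicAlgCl ℓ) n), ρ.toGaloisRep.IsIrreducible → ((∀ᶠ v : IsDedekindDomain.HeightOneSpectrum (NumberField.RingOfIntegers K) in Filter.cofinite, ρ.IsUnramifiedAt v) ∧ ∀ (v : IsDedekindDomain.HeightOneSpectrum (NumberField.RingOfIntegers K)) (hv : ((ℓ : ℕ) : NumberField.RingOfIntegers K) ∈ v.asIdeal), (Literature.NumberTheory.PAdicHodge.fontainePstAdicCompletion v ℓ hv).IsDeRhamFramed (ρ.toLocal v)) → (∀ (L : Type) [Field L] [NumberField L] [Algebra K L], (ρ.restrictField L).toGaloisRep.IsIrreducible) →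 ¬ (∃ (K₀ : Type) (_ : Field K₀) (_ : NumberField K₀) (M : Type) (_ : Field M) (_ : NumberField M) (_ : Algebra K M) (_ : Algebra K₀ M), (NumberField.IsTotallyReal K₀ ∨ NumberField.IsCMField K₀) ∧ (∃ (N : Type) (_ : Field N) (_ : NumberField N) (_ : Algebra K N) (_ : Algebra M N) (_ : IsScalarTower K M N), IsGalois K N ∧ IsSolvable (N ≃ₐ[K] N)) ∧ ∃ ρ₀ : Literature.NumberTheory.GaloisRepresentations.FramedGaloisRep K₀ (PadicAlgCl ℓ) n, ρ₀.toGaloisRep.IsIrreducible ∧ ((∀ᶠ v : IsDedekindDomain.HeightOneSpectrum (NumberField.RingOfIntegers K₀) in Filter.cofinite, ρ₀.IsUnramifiedAt v) ∧ ∀ (v : IsDedekindDomain.HeightOneSpectrum (NumberField.RingOfIntegers K₀)) (hv : ((ℓ : ℕ) : NumberField.RingOfIntegers K₀) ∈ v.asIdeal), (Literature.NumberTheory.PAdicHodge.fontainePstAdicCompletion v ℓ hv).IsDeRhamFramed (ρ₀.toLocal v)) ∧ (∀ (L : Type) [Field L] [NumberField L] [Algebra K₀ L], (ρ₀.restrictField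 L).toGaloisRep.IsIrreducible) ∧ ∀ g : Field.absoluteGaloisGroup M, ∃ c : PadicAlgCl ℓ, c ≠ 0 ∧ Literature.NumberTheory.GaloisRepresentations.FramedRep.charpoly (ρ.restrictField M) g = (Literature.NumberTheory.GaloisRepresentations.FramedRep.charpoly (ρ₀.restrictField M) g).scaleRoots c) → ∃ π : Literature.NumberTheory.Automorphic.CuspidalAutomorphicRepData n K hcpt, π.1.IsLAlgebraic ∧ (∀ (B : ℕ) (S' : Set (IsDedekindDomain.HeightOneSpectrum (NumberField.RingOfIntegers K))), S'.Finite → ∃ T : Set (IsDedekindDomain.HeightOneSpectrum (NumberField.RingOfIntegers K)), T.Finite ∧ Disjoint T S' ∧ (∀ (H : Type) [Group H] [Finite H], Nat.card H ≤ B → ∀ φ : Field.absoluteGaloisGroup K →* H, IsOpen (φ.ker : Set (Field.absoluteGaloisGroup K)) → (∀ v : IsDedekindDomain.HeightOneSpectrum (NumberField.RingOfIntegers K), v ∉ S' → ∀ 𝔓 ∈ v.primesAbove, ∀ σ ∈ 𝔓.inertia (Field.absoluteGaloisGroup K), φ σ = 1) → ∀ g : Field.absoluteGaloisGroup K, ∃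 v ∈ T, ∃ 𝔓 ∈ v.primesAbove, ∃ σ : Field.absoluteGaloisGroup K, IsArithFrobAt (NumberField.RingOfIntegers K) σ 𝔓 ∧ IsConj (φ σ) (φ g)) ∧ ∀ v ∈ T, SatakeFrobCompatibleAt ι π.1 ρ v)

/-- item stmt-Langlands-28080 · crux · RESIDUAL (gen 0; summit-strength until shown otherwise, D-0170) · leaf IDEA-NEEDED · rank 3 · open · by planner
why it might fail: No Galois representation has ever been attached to a cuspidal π of GL_n (n ≥ 2) over a field that is neither TR nor CM: l₀ = r₂ > 0, no Shimura variety over any extension (a field containing K is not TR/CM either); Calegari–Venkatesh/Calegari–Geraghty torsion functoriality is conjectural there.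
sources: Literature.Barriers.Langlands.ShimuraVarietyRealizationBarrier (Goldring 2016 §4.4.3 «Other number fields … no known way to directly relate π to the cohomology of an algebraic variety»; Harish-Chandra equal-rank criterion `equalRankResGL_iff`), host items SatakeAvatarExistence = stmt-Langlands-17415 (W⁺) and RegularSatakeAvatars 23598 (E); G = DarkPrimitiveAvatars 29147 (BaseFieldAscent) — AVC is their sub-box on PRIM's box (kernel `avc_of_satakeAvatarExistence`), HarrisLanTaylorThorne2016 (doi:10.1186/s40687-016-0078-5) / Scholze2015 (doi:10.4007/annals.2015.182.3.3): constructions need F TR or CM, Calegari–Geraghty 2018 (doi:10.1007/s00222-017-0749-x) §1: beyond Shimura varieties Galois representations for torsion/Betti classes are conjectural (l₀ > 0)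
[AVC · AVATARS FOR CERTIFIED CLASSES · DECLARED RESIDUAL · WEAKER than the summit (node
`avc_of_langlands`) · SUB-BOX of W⁺ = SatakeAvatarExistence 17415 (node
`avc_of_satakeAvatarExistence`, by name) and of E 23598 / G 29147 · BARRIER
ShimuraVarietyRealizationBarrier head-on · IDEA-NEEDED] For every number field K, n ≥ 2, ℓ, ι and
every L-algebraic cuspidal π of GL_n/K which is certified (as in CERT, every depth) against SOME ρ
in PRIM's box (box conjuncts VERBATIM), there is a framed ρ_π : Γ_K → GL_n(ℚ̄_ℓ) Satake–Frobenius
compatible with π at almost all places. Non-vacuous only over K that are neither totally real nor CM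
(PRIM's box is empty over TR/CM K: host kernel `insolvableCells_vacuous_on_TRCM`), i.e. exactly
where direction (A) has no construction for any cuspidal π. This is the (A)-dark core of the cell,
made LOAD-BEARING for the (B)-dark target by the Faltings–Serre transfer (node `closes`). -/
@[route_item "route-Langlands-FaltingsSerreTransfer", crux (bottleneck := idea) (source := "ledger wanted_by.residual on stmt-Langlands-28080, 2026-09-01")]
def CertificateAvatars : Prop :=
  ∀ (K : Type) [Field K] [NumberField K] (n : ℕ) (hcpt : Literature.NumberTheory.Automorphic.isCompact_glFiniteIntegralLevel n K), 2 ≤ n → ∀ (ℓ : ℕ) [Fact ℓ.Prime] (ι : PadicAlgCl ℓ ≃+* ℂ) (π : Literature.NumberTheory.Automorphic.CuspidalAutomorphicRepData n K hcpt), π.1.IsLAlgebraic → (∃ ρ : Literature.NumberTheory.GaloisRepresentations.FramedGaloisRep K (PadicAlgCl ℓ) n, ρ.toGaloisRep.IsIrreducible ∧ ((∀ᶠ v : IsDedekindDomain.HeightOneSpectrum (NumberField.RingOfIntegers K) in Filter.cofinite, ρ.IsUnramifiedAt v) ∧ ∀ (v : IsDedekindDomain.HeightOneSpectrum (NumberField.RingOfIntegers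 K)) (hv : ((ℓ : ℕ) : NumberField.RingOfIntegers K) ∈ v.asIdeal), (Literature.NumberTheory.PAdicHodge.fontainePstAdicCompletion v ℓ hv).IsDeRhamFramed (ρ.toLocal v)) ∧ (∀ (L : Type) [Field L] [NumberField L] [Algebra K L], (ρ.restrictField L).toGaloisRep.IsIrreducible) ∧ ¬ (∃ (K₀ : Type) (_ : Field K₀) (_ : NumberField K₀) (M : Type) (_ : Field M) (_ : NumberField M) (_ : Algebra K M) (_ : Algebra K₀ M), (NumberField.IsTotallyReal K₀ ∨ NumberField.IsCMField K₀) ∧ (∃ (N : Type) (_ : Field N) (_ : NumberField N) (_ : Algebra K N) (_ : Algebra M N) (_ : IsScalarTower K M N), IsGalois K N ∧ IsSolvable (N ≃ₐ[K] N)) ∧ ∃ ρ₀ : Literature.NumberTheory.GaloisRepresentations.FramedGaloisRep K₀ (PadicAlgCl ℓ) n, ρ₀.toGaloisRep.IsIrreducible ∧ ((∀ᶠ v : IsDedekindDomain.HeightOneSpectrum (NumberField.RingOfIntegers K₀) in Filter.cofinite, ρ₀.IsUnramifiedAt v) ∧ ∀ (v : IsDedekindDomain.HeightOneSpectrum (NumberField.RingOfIntegers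 K₀)) (hv : ((ℓ : ℕ) : NumberField.RingOfIntegers K₀) ∈ v.asIdeal), (Literature.NumberTheory.PAdicHodge.fontainePstAdicCompletion v ℓ hv).IsDeRhamFramed (ρ₀.toLocal v)) ∧ (∀ (L : Type) [Field L] [NumberField L] [Algebra K₀ L], (ρ₀.restrictField L).toGaloisRep.IsIrreducible) ∧ ∀ g : Field.absoluteGaloisGroup M, ∃ c : PadicAlgCl ℓ, c ≠ 0 ∧ Literature.NumberTheory.GaloisRepresentations.FramedRep.charpoly (ρ.restrictField M) g = (Literature.NumberTheory.GaloisRepresentations.FramedRep.charpoly (ρ₀.restrictField M) g).scaleRoots c) ∧ (∀ (B : ℕ) (S' : Set (IsDedekindDomain.HeightOneSpectrum (NumberField.RingOfIntegers K))), S'.Finite → ∃ T : Set (IsDedekindDomain.HeightOneSpectrum (NumberField.RingOfIntegers K)), T.Finite ∧ Disjoint T S' ∧ (∀ (H : Type) [Group H] [Finite H], Nat.card H ≤ B → ∀ φ : Field.absoluteGaloisGroup K →* H, IsOpen (φ.ker : Set (Field.absoluteGaloisGroup K)) → (∀ v : IsDedekindDomain.HeightOneSpectrum (NumberField.RingOfIntegers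 K), v ∉ S' → ∀ 𝔓 ∈ v.primesAbove, ∀ σ ∈ 𝔓.inertia (Field.absoluteGaloisGroup K), φ σ = 1) → ∀ g : Field.absoluteGaloisGroup K, ∃ v ∈ T, ∃ 𝔓 ∈ v.primesAbove, ∃ σ : Field.absoluteGaloisGroup K, IsArithFrobAt (NumberField.RingOfIntegers K) σ 𝔓 ∧ IsConj (φ σ) (φ g)) ∧ ∀ v ∈ T, SatakeFrobCompatibleAt ι π.1 ρ v)) → ∃ ρπ : Literature.NumberTheory.GaloisRepresentations.FramedGaloisRep K (PadicAlgCl ℓ) n, ∀ᶠ v : IsDedekindDomain.HeightOneSpectrum (NumberField.RingOfIntegers K) in Filter.cofinite, SatakeFrobCompatibleAt ι π.1 ρπ v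

/-- item stmt-Langlands-28081 · support · rank 9 · closed · proved by Summit.Langlands.Langlands.Theorems.faltingsSerreCriterion_proof (prover) · by planner
why it might fail: Routine but long: needs compact image ⊂ GL_n(𝒪_E) for a finite E/ℚ_ℓ (Baire category over ℚ̄_ℓ = PadicAlgCl ℓ), the inertia/`primesAbove` bookkeeping of IntegralGaloisAction, and Newton's identities for charpolys from traces of powers.
sources: arXiv:2510.12956 p.3 (Faltings: finitely many Frobenius traces decide) and p.8 (deviation group δ(G) ⊂ (M/ϖM)^×, M = 𝒪_E-span of (ρ₁⊕ρ₂)(G_K) ⊂ M_n(𝒪_E)²; «semisimplifications isomorphic iff traces agree on a set covering δ(G)»; K_δ/K unramified outside S) [corpus:paper:arxiv-2510.12956 p8], Faltings 1983 (Invent. Math. 73, proof of Satz 5); Serre, Résumé des cours 1984–85 (Œuvres IV, no. 135); doi:10.1090/conm/067/902596 (Livné 1987, Thm 4.3), doi:10.1016/j.jalgebra.2007.03.018 = arXiv:math/0506053 (Grenié 2007: general p-adic n-dimensional comparison) [corpus:paper:arxiv-math_0506053], tree (nearest decl, NOT this statement): Literature.NumberTheory.FaltingsSerre.traceEq_of_faltingsSerre(_holds)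 (BPPTVY Alg. 2.4.1 kernel, PROVED; ℤ_ℓ-valued, residually ABSOLUTELY IRREDUCIBLE, obstructing cocycles) + Carayol exists_conj_eq_of_trace_eq_of_isAbsIrreducible_residual_holds, [galaxy:panama:506015866945592] Cornell–Silverman–Stevens 1997 (FS method), [galaxy:pdf:3692044544767420] ANT 13:5 (BPPTVY issue)
[FS · FALTINGS–SERRE CRITERION, CLASS-COVERING FORM · PRINT · provable now (est. L)] For continuous
framed ρ₁, ρ₂ : Γ_K → GL_n(ℚ̄_ℓ) there are B ∈ ℕ and a finite set S of places such that: if T is (S,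
B)-covering and at every v ∈ T one polynomial is the characteristic polynomial of every arithmetic
Frobenius above v for both ρ₁ and ρ₂ (`FramedGaloisRep.HasFrobCharpolyAt`), then charpoly ρ₁(σ) =
charpoly ρ₂(σ) for all σ ∈ Γ_K. Proof (Faltings 1983 / Serre 1984–85 / Grenié 2007 /
arXiv:2510.12956 p.8): images conjugate into GL_n(𝒪_E) (Baire), M := 𝒪_E-span of (ρ₁, ρ₂)(Γ_K) ⊂
M_n(𝒪_E)², H := δ(Γ_K) ⊂ (M/ϖM)^× (|H| < q^{2n²} =: B), S := primes ramified in K_δ; L := tr∘pr₁ −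
tr∘pr₂ vanishes on the T-Frobenius images, is invariant under M^×-conjugation, so L(ρ(g)) ∈ ϖ L(M)
for all g (covering), Nakayama ⇒ L = 0: equal traces on Γ_K, Newton (char 0) ⇒ equal characteristic
polynomials. NEAREST TREE DECL (different statement):
`Literature.NumberTheory.FaltingsSerre.traceEq_of_faltingsSerre` (+ `_holds`, PROVED) = the BPPTVY
refinement for ℤ_ℓ-valued ρ with residually ABSOLUTELY IRREDUCIBLE ρ̄ and obstructing-cocycle
completeness — inapplicable to the residually reducible ρ in PRIM's box, wh -/
@[route_item "route-Langlands-FaltingsSerreTransfer", crux]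
def FaltingsSerreCriterion : Prop :=
  ∀ (K : Type) [Field K] [NumberField K] (ℓ : ℕ) [Fact ℓ.Prime] (n : ℕ) (ρ₁ ρ₂ : Literature.NumberTheory.GaloisRepresentations.FramedGaloisRep K (PadicAlgCl ℓ) n), ∃ (B : ℕ) (S : Set (IsDedekindDomain.HeightOneSpectrum (NumberField.RingOfIntegers K))), S.Finite ∧ ∀ T : Set (IsDedekindDomain.HeightOneSpectrum (NumberField.RingOfIntegers K)), (∀ (H : Type) [Group H] [Finite H], Nat.card H ≤ B → ∀ φ : Field.absoluteGaloisGroup K →* H, IsOpen (φ.ker : Set (Field.absoluteGaloisGroup K)) → (∀ v : IsDedekindDomain.HeightOneSpectrum (NumberField.RingOfIntegers K), v ∉ S → ∀ 𝔓 ∈ v.primesAbove, ∀ σ ∈ 𝔓.inertia (Field.absoluteGaloisGroup K), φ σ = 1) → ∀ g : Field.absoluteGaloisGroup K, ∃ v ∈ T, ∃ 𝔓 ∈ v.primesAbove, ∃ σ : Field.absoluteGaloisGroup K, IsArithFrobAt (NumberField.RingOfIntegers K) σ 𝔓 ∧ IsConj (φ σ) (φ g)) → (∀ v ∈ T, ∃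 P : Polynomial (PadicAlgCl ℓ), ρ₁.HasFrobCharpolyAt v P ∧ ρ₂.HasFrobCharpolyAt v P) → ∀ σ : Field.absoluteGaloisGroup K, Literature.NumberTheory.GaloisRepresentations.FramedRep.charpoly ρ₁ σ = Literature.NumberTheory.GaloisRepresentations.FramedRep.charpoly ρ₂ σ

-- `FaltingsSerreCriterion` holds: proved by `Summit.Langlands.Langlands.Theorems.faltingsSerreCriterion_proof` (its module imports this route file, so no `_holds` link can be stated here).

/-- item stmt-Langlands-28082 · assembly · rank 1 · closed · proved by Summit.Langlands.Langlands.Theorems.faltingsSerreTransfer_assembly_proof (prover) · by planner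
why it might fail: none: proved in the node (closes).
sources: node HOME/nodes/lens-3-g19-FaltingsSerreTransfer.lean
FS → CERT → AVC → PRIM: the curried deciding theorem `closes` (node Theorems.FSTransfer.closes /
assembly_proof, 0 sorry, axioms standard). -/
@[route_item "route-Langlands-FaltingsSerreTransfer"]
def Assembly : Prop :=
  FaltingsSerreCriterion → CertifiedMatching → CertificateAvatars → Summit.Langlands.Langlands.Theses.DescentTypeTrichotomy.PrimitiveTypeAutomorphy

-- `Assembly` holds: proved by `Summit.Langlands.Langlands.Theorems.faltingsSerreTransfer_assembly_proof` (its module imports this route file, so no `_holds` link can be stated here).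

/-! D-0027 §2.1 — DECIDING THEOREM (planner-authored via `route open/edit --closes-file`; by planner-decomp-langlands-writer-1-g7-0 2026-08-31T05:36:45Z):
its hypotheses are this route's items and its conclusion the registered leaf `Summit.Langlands.Langlands.Theses.DescentTypeTrichotomy.PrimitiveTypeAutomorphy` (rung None, D-0061) (glue_lint), and it elaborates with this file. -/

/- D-0027 §2.1 deciding theorem for the CHILD ROUTE `FaltingsSerreTransfer` (decomp-langlands lens-3 gen 19;
   `--refines route-Langlands-DescentTypeTrichotomy:PrimitiveTypeAutomorphy`, stmt-Langlands-29575).  CERT supplies π, L-algebraicity and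
   certificates of every depth; AVC supplies an ℓ-adic avatar ρ_π of π (fed the certified box datum ⟨ρ, …, hcert⟩); FS applied to (ρ, ρ_π) on a
   certificate of the FS depth avoiding S_FS ∪ (the avatar's finite exceptional set) gives charpoly ρ = charpoly ρ_π on Γ_K (the common Frobenius
   polynomial at v ∈ T is arithFrobPolyOfSatake of THE Satake parameter — uniqueness `hasSatakeParamAt_unique_holds`, PROVED), whence ρ inherits
   the avatar's a.e. Satake–Frobenius compatibility; unramifiedness a.e. is PRIM's own hypothesis `hgeom.1`.  = node kernel
   `Summit.Langlands.Langlands.Theorems.FSTransfer.closes` (HOME/nodes/lens-3-g19-FaltingsSerreTransfer.lean; axioms propext, Classical.choice,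
   Quot.sound).  Every binder is used. -/
@[closes "route-Langlands-FaltingsSerreTransfer"] theorem closes (hFS : FaltingsSerreCriterion) (hC : CertifiedMatching) (hA : CertificateAvatars) :
    Summit.Langlands.Langlands.Theses.DescentTypeTrichotomy.PrimitiveTypeAutomorphy := by
  intro K _ _ n hcpt hn ℓ _ ι ρ hirr hgeom hLie hnpsat
  obtain ⟨π, hLalg, hcert⟩ := hC K n hcpt hn ℓ ι ρ hirr hgeom hLie hnpsat
  obtain ⟨ρπ, hρπ⟩ := hA K n hcpt hn ℓ ι π hLalg ⟨ρ, hirr, hgeom, hLie, hnpsat, hcert⟩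
  refine ⟨π, hLalg, ?_⟩
  obtain ⟨B, S, hSfin, hFS'⟩ := hFS K ℓ n ρ ρπ
  have hE : {v : IsDedekindDomain.HeightOneSpectrum (NumberField.RingOfIntegers K) | ¬ SatakeFrobCompatibleAt ι π.1 ρπ v}.Finite :=
    Filter.eventually_cofinite.mp hρπ
  obtain ⟨T, -, hTdisj, hTcov, hTmatch⟩ :=
    hcert B (S ∪ {v : IsDedekindDomain.HeightOneSpectrum (NumberField.RingOfIntegers K) | ¬ SatakeFrobCompatibleAt ι π.1 ρπ v}) (hSfin.union hE)
  have hchar : ∀ σ : Field.absoluteGaloisGroup K,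
      Literature.NumberTheory.GaloisRepresentations.FramedRep.charpoly ρ σ =
        Literature.NumberTheory.GaloisRepresentations.FramedRep.charpoly ρπ σ := by
    refine hFS' T ?_ ?_
    · intro H _ _ hH φ hφ hunrφ g
      exact hTcov H hH φ hφ (fun v hv => hunrφ v (fun hS => hv (Set.mem_union_left _ hS))) g
    · intro v hvT
      obtain ⟨α, hπα, -, hρP⟩ := hTmatch v hvT
      have hgood : SatakeFrobCompatibleAt ι π.1 ρπ v := by
        by_contra hbad
        exact (Set.disjoint_left.mp hTdisj hvT) (Set.mem_union_right _ hbad)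
      obtain ⟨α', hπα', -, hρπP⟩ := hgood
      obtain rfl : α = α' :=
        Literature.NumberTheory.Automorphic.AutomorphicRepData.hasSatakeParamAt_unique_holds π.1 hπα hπα'
      exact ⟨_, hρP, hρπP⟩
  filter_upwards [hρπ, hgeom.1] with v hv hvunr
  obtain ⟨α, hπα, -, hP⟩ := hv
  refine ⟨α, hπα, hvunr, ?_⟩
  intro 𝔓 h𝔓 σ hσ
  rw [hchar σ]
  exact hP 𝔓 h𝔓 σ hσ

end Summit.Langlands.Langlands.Theses.FaltingsSerreTransfer
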